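import Summits.BirchSwinnertonDyer.Rank1Residual.P2.CongruentNumberHalvingChainTwoDescent
import Summits.BirchSwinnertonDyer.Rank1Residual.P2.CongruentNumberHalvingBitsPairKit
import HarnessLib

/-!
# Sub-lane «bsd-p2»: the HALVING CHAIN — the MISS face of the halving-bits door (p350663 §3, uniform in
# `k`): a displayed chain of the WRONG depth certifies `¬ BSD(E_n, 2)` UNDER the displayed `T_even`
# (pure `2`-descent bookkeeping over `ℚ` from tree theorems + the chain draft; 0 def; 0 facts; 0 (K);
# no pair, no numeral)

HONEST FRAMING (sub-lane «bsd-p2», run/shared/lean/b2b/bsd-rank1-residual/p2/, verbatim in every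
file): the target of record is the FULL Birch–Swinnerton-Dyer formula for EVERY analytic-rank `≤ 1`
`E/ℚ` at ALL primes INCLUDING `2`; the odd-prime class ledger is referee A's; the `2`-part is OPEN
(cells O1 = X5 ∖ CM and O12 = the CM corner) and under census by «bsd-p2». Census / instrument
output at `2` = EVIDENCE / conjecture items with held-out validation, NEVER a Literature fact;
certificates close PAIRS (one isogeny class, `p = 2`), never classes. THIS FILE is unconditional
group-theoretic bookkeeping: it COMPOSES the tree's halving-bits door
`rankOne_sha_bsdp_two_iff_halvingBits_congruentNumberCurve_two_mul_prod` (p350663 §3: GIVEN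
`hT : L′(E_n, 1) = 4·Ω·ĥ(s)`, `BSD(E_n, 2) ⟺ b_{k−2}(s) ∧ ¬ b_{k−1}(s)`) with the chain draft's ladder
(`P2/CongruentNumberHalvingChainTwoDescent.lean` §1) in the TWO ways a per-pair halving chain can
DISAGREE with Monsky's exponent law read E-side — the «MISS certificate» of the lane's (E4)
(p2-typer GEN 29 memo `p2/typer/GEN29-T181-K4-INSTANCE.md` (S3); p2-lead GEN 10 LEAD-OKS BATCH 94 (i)):
* §1 bit monotonicity `b_j(s) ⟹ b_i(s)` (`i ≤ j`);
* §2 TOO LONG: a displayed `(k−1)`-fold half `R` of `s` modulo `E_n[2]` (`2^{k−1} • R = s + T₀`) gives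
  `b_{k−1}(s)`, hence `¬ BSD(E_n, 2)` under `hT`;
* §3 TOO SHORT: a displayed `j`-fold half `R` (`j + 1 ≤ k − 2`) whose square classes `(x(R)+n, x(R))`
  avoid `δ(E_n[2])` gives `¬ b_{j+1}(s)`, hence `¬ b_{k−2}(s)`, hence `¬ BSD(E_n, 2)` under `hT`;
* §4 the same two statements with every point supplied by COORDINATES (kit
  `P2/CongruentNumberHalvingBitsPairKit.lean`), the shape a generated MISS instance would instantiate.
WHAT SUCH A CERTIFICATE MEANS (p2-lead GEN 10 T-177 (β), verbatim in substance): under `hGZK`, `hMe`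
and the cell data the door also gives `ord_{s=1} L = 1`, rank `1`, `Ш(E_n)[2^∞] = 0`; so a MISS row
typed through §2/§3 reads «IF `T_even(n)` held for the emitted `s` THEN `BSD(E_n, 2)` would be FALSE» —
i.e. it is EVIDENCE AGAINST the transport hypothesis `hT` for that emitted point (index `τ ≠ 1`) or
against the implementation, NEVER a finding about BSD, and it books nothing. No MISS row exists at
`ℓ ≤ 4` (PT17A 16/16); NO `ℓ = 5` n appears here or was computed for this file (BLINDNESS untouched).
It closes NO pair, states no conjecture, adds no fact, touches no (K) / mark / tier. LANDING ORDER (if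
ever ruled): after the chain draft (p2-typer GEN 18 @f5bf1bd607a79ed8) and the kit exist in the tree;
validated byte-identically inside a combined scratch (rc 0). Unit `b2b-bsdres-p2-typer` GEN 31 —
SCRATCH (zero-proposal readiness (R4); p2-lead's standing word: nothing proposed before the SWEEP).

References: [SilvermanAEC2009] Prop. X.1.4, Thm. VIII.9.3; [Knapp1993] Lemma 4.20;
[Monsky1990MockHeegner] Remark (3) (p. 67); [Miller2011LMS] Def. 1.1; HOME `p2/STRUCTURE-p2.md` §3/§7;
`p2/typer/GEN29-T181-K4-INSTANCE.md` (S3) (E4); `p2/LEAD-OKS.md` § GEN 10 BATCH 94.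
-/

noncomputable section

open WeierstrassCurve WeierstrassCurve.Affine WeierstrassCurve.Affine.Point
  Literature.NumberTheory.EllipticCurves Literature.NumberTheory.EllipticCurves.TwoDescentLocal
  Literature.NumberTheory.EllipticCurves.Rank1Residual
  Literature.NumberTheory.EllipticCurves.Rank1Residual.Typed
  Literature.NumberTheory.EllipticCurves.HeathBrown1994

set_option autoImplicit false

namespace Summit.BirchSwinnertonDyer.Rank1Residual.P2

/-! ## §1 Bit monotonicity -/

section Monotone

variable [inst : DecidableEq ℚ] {n : ℕ}

/-- **Halving bits are monotone**: `s ∈ 2^j E_n(ℚ) + E_n[2]` and `i ≤ j` ⟹ `s ∈ 2^i E_n(ℚ) + E_n[2]`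
(`2^j • R = 2^i • (2^{j−i} • R)`). [folklore] -/
theorem halvingBit_mono (s : (congruentNumberCurve n).toAffine.Point) {i j : ℕ} (hij : i ≤ j)
    (h : ∃ T R : (congruentNumberCurve n).toAffine.Point, (2 : ℕ) • T = 0 ∧ s + T = (2 ^ j : ℕ) • R) :
    ∃ T R : (congruentNumberCurve n).toAffine.Point, (2 : ℕ) • T = 0 ∧ s + T = (2 ^ i : ℕ) • R := by
  obtain ⟨T, R, hT, hR⟩ := h
  refine ⟨T, (2 ^ (j - i) : ℕ) • R, hT, ?_⟩
  rw [hR, ← mul_nsmul', ← pow_add, Nat.add_sub_cancel' hij]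

end Monotone

/-! ## §2–§3 The two MISS certificates on abstract points, uniform in `k ≥ 2` -/

section Miss

variable [inst : DecidableEq ℚ] {k : ℕ} (p : Fin k → ℕ)

/-- **MISS, TOO LONG (binder `k ≥ 2`; modulo `hGZK`, `hMe` and the DISPLAYED `hT`).** Even cell data
(`n = 2∏p ≡ 6 (mod 8)`, `s(n) = 1`), `s ∈ E_n(ℚ)` with `2 • s ≠ O`, `hT : L′(E_n, 1) = 4·Ω·ĥ(s)`, and ONE
displayed point `R` with `2^{k−1} • R = s + T₀` (`2 • T₀ = O`; per pair: `k − 1` coordinate doublings —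
one MORE than the law predicts) give `ord_{s=1} L = 1 ∧ rank 1 ∧ Ш(E_n)[2^∞] = 0 ∧ ¬ BSD(E_n, 2)`:
the chain IS the bit `b_{k−1}(s)`, which the door forbids. Reading: evidence against `hT` for this
`s` (or the implementation), never a finding; closes nothing.
[cite: Monsky1990MockHeegner, Remark (3) (p. 67)] [cite: SilvermanAEC2009, Thm. VIII.9.3] -/
theorem rankOne_sha_not_bsdp_two_of_pow_nsmul_eq_succ_congruentNumberCurve_two_mul_prod
    (hGZK : rank_eq_analyticRank_of_analyticRank_le_one) (hMe : monsky_card_selmerGroup_two_even)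
    (hk : 2 ≤ k) (hp : ∀ i, (p i).Prime) (hinj : Function.Injective p) {n : ℕ} (hn : 2 * ∏ i, p i = n)
    (h8 : n % 8 = 6) (hs : monskySelmerRankEven p = 1)
    (s : (congruentNumberCurve n).toAffine.Point) (hs2 : (2 : ℕ) • s ≠ 0)
    (hT : deriv (congruentNumberCurve n).entireLFunction 1 =
      (4 : ℂ) * ((congruentNumberCurve n).realPeriodRat : ℂ) * (s.canonicalHeight : ℂ))
    (R T₀ : (congruentNumberCurve n).toAffine.Point) (hT₀ : (2 : ℕ) • T₀ = 0)
    (hR : (2 ^ (k - 1) : ℕ) • R = s + T₀) :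
    (congruentNumberCurve n).analyticRank = 1 ∧ (congruentNumberCurve n).mordellWeilRank = 1 ∧
      AddCommGroup.primaryComponent (congruentNumberCurve n).sha 2 = ⊥ ∧
      ¬ BSDp (congruentNumberCurve n) 2 := by
  obtain ⟨hr1, hrank, hbot, hiff⟩ :=
    rankOne_sha_bsdp_two_iff_halvingBits_congruentNumberCurve_two_mul_prod p hGZK hMe hk hp hinj hn h8
      hs s hs2 hT
  exact ⟨hr1, hrank, hbot, fun hBSD => (hiff.mp hBSD).2 (halvingBit_of_pow_nsmul_eq s R T₀ (k - 1) hT₀ hR)⟩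

/-- **MISS, TOO SHORT (binder `k ≥ 2`; modulo `hGZK`, `hMe` and the DISPLAYED `hT`).** Even cell data,
`s` with `2 • s ≠ O`, `hT`, and ONE displayed `j`-fold half `R` of `s` modulo `E_n[2]`
(`2^j • R = s + T₀`, `2 • T₀ = O`) at a level `j + 1 ≤ k − 2` whose descent image avoids
`δ(E_n[2])` (`∀ T, 2 • T = O → δ R ≠ δ T`: four square-class inequalities on the coordinates of `R`,
p352033 §2) give `ord_{s=1} L = 1 ∧ rank 1 ∧ Ш(E_n)[2^∞] = 0 ∧ ¬ BSD(E_n, 2)`: `¬ b_{j+1}(s)` by the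
ladder, so `¬ b_{k−2}(s)` by monotonicity, which the door requires. Reading as in the TOO-LONG case.
[cite: Monsky1990MockHeegner, Remark (3) (p. 67)] [cite: SilvermanAEC2009, Prop. X.1.4]
[cite: Knapp1993, Lemma 4.20] -/
theorem rankOne_sha_not_bsdp_two_of_twoDescentMap_ne_of_pow_nsmul_eq_congruentNumberCurve_two_mul_prod
    (hGZK : rank_eq_analyticRank_of_analyticRank_le_one) (hMe : monsky_card_selmerGroup_two_even)
    (hk : 2 ≤ k) (hp : ∀ i, (p i).Prime) (hinj : Function.Injective p) {n : ℕ} (hn : 2 * ∏ i, p i = n)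
    (h8 : n % 8 = 6) (hs : monskySelmerRankEven p = 1) (hn0 : n ≠ 0)
    (s : (congruentNumberCurve n).toAffine.Point) (hs2 : (2 : ℕ) • s ≠ 0)
    (hT : deriv (congruentNumberCurve n).entireLFunction 1 =
      (4 : ℂ) * ((congruentNumberCurve n).realPeriodRat : ℂ) * (s.canonicalHeight : ℂ))
    (R T₀ : (congruentNumberCurve n).toAffine.Point) (j : ℕ) (hj : j + 1 ≤ k - 2)
    (hT₀ : (2 : ℕ) • T₀ = 0) (hR : (2 ^ j : ℕ) • R = s + T₀)
    (hδ : haveI := isElliptic_congruentNumberCurve hn0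
      ∀ T : (congruentNumberCurve n).toAffine.Point, (2 : ℕ) • T = 0 →
        twoDescentMap (splitTwoTorsion_cn n) R ≠ twoDescentMap (splitTwoTorsion_cn n) T) :
    (congruentNumberCurve n).analyticRank = 1 ∧ (congruentNumberCurve n).mordellWeilRank = 1 ∧
      AddCommGroup.primaryComponent (congruentNumberCurve n).sha 2 = ⊥ ∧
      ¬ BSDp (congruentNumberCurve n) 2 := by
  have hsq : Squarefree n :=
    hn ▸ squarefree_two_mul_prod_of_injective p hp (odd_of_two_mul_prod_mod_eight_six p hn h8) hinj
  obtain ⟨hr1, hrank, hbot, hiff⟩ :=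
    rankOne_sha_bsdp_two_iff_halvingBits_congruentNumberCurve_two_mul_prod p hGZK hMe hk hp hinj hn h8
      hs s hs2 hT
  exact ⟨hr1, hrank, hbot, fun hBSD =>
    not_halvingBit_succ_of_twoDescentMap_ne hsq s R T₀ j hT₀ hR hδ (halvingBit_mono s hj (hiff.mp hBSD).1)⟩

end Miss

/-! ## §4 The two MISS certificates with every point supplied by coordinates (kit §1/§2) — the shape a
generated MISS instance instantiates (no pair instantiated here) -/

section Coordinates

variable [inst : DecidableEq ℚ] {k : ℕ} (p : Fin k → ℕ)

/-- **MISS, TOO LONG, on coordinates** (modulo `hGZK`, `hMe` and the DISPLAYED `hT`): cell data;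
`s = (x_s, y_s)` with `y_s ≠ 0`; `hT`; ONE point `R = (x_R, y_R)` with `2^{k−1} • R = s + T₀` (per pair:
`k − 1` displayed doublings folded by `pow_nsmul_eq_of_two_nsmul_eq`) ⟹
`ord_{s=1} L = 1 ∧ rank 1 ∧ Ш[2^∞] = 0 ∧ ¬ BSD(E_n, 2)`. [cite: Monsky1990MockHeegner, Remark (3) (p. 67)]
[cite: SilvermanAEC2009, Thm. VIII.9.3] -/
theorem rankOne_sha_not_bsdp_two_of_coordinates_pow_nsmul_eq_succ_congruentNumberCurve_two_mul_prod
    (hGZK : rank_eq_analyticRank_of_analyticRank_le_one) (hMe : monsky_card_selmerGroup_two_even)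
    (hk : 2 ≤ k) (hp : ∀ i, (p i).Prime) (hinj : Function.Injective p) {n : ℕ}
    (hn : 2 * ∏ i, p i = n) (h8 : n % 8 = 6) (hs : monskySelmerRankEven p = 1) (hn0 : n ≠ 0)
    {xs ys : ℚ} (hs_on : (congruentNumberCurve n).toAffine.Nonsingular xs ys) (hys : ys ≠ 0)
    (hT : deriv (congruentNumberCurve n).entireLFunction 1 =
      (4 : ℂ) * ((congruentNumberCurve n).realPeriodRat : ℂ) *
        ((Point.some xs ys hs_on : (congruentNumberCurve n).toAffine.Point).canonicalHeight : ℂ))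
    {xR yR : ℚ} (hR_on : (congruentNumberCurve n).toAffine.Nonsingular xR yR)
    (T₀ : (congruentNumberCurve n).toAffine.Point) (hT₀ : (2 : ℕ) • T₀ = 0)
    (hR : (2 ^ (k - 1) : ℕ) • (Point.some xR yR hR_on : (congruentNumberCurve n).toAffine.Point) =
      Point.some xs ys hs_on + T₀) :
    (congruentNumberCurve n).analyticRank = 1 ∧ (congruentNumberCurve n).mordellWeilRank = 1 ∧
      AddCommGroup.primaryComponent (congruentNumberCurve n).sha 2 = ⊥ ∧
      ¬ BSDp (congruentNumberCurve n) 2 :=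
  rankOne_sha_not_bsdp_two_of_pow_nsmul_eq_succ_congruentNumberCurve_two_mul_prod p hGZK hMe hk hp hinj
    hn h8 hs (Point.some xs ys hs_on) (two_nsmul_some_ne_zero_congruentNumberCurve hn0 hs_on hys) hT
    (Point.some xR yR hR_on) T₀ hT₀ hR

/-- **MISS, TOO SHORT, on coordinates** (modulo `hGZK`, `hMe` and the DISPLAYED `hT`): cell data;
`s = (x_s, y_s)` with `y_s ≠ 0`; `hT`; ONE point `R = (x_R, y_R)` (`y_R ≠ 0`) with `2^j • R = s + T₀`
at a level `j + 1 ≤ k − 2`, and four non-square witnesses putting `δ R = (x_R + n, x_R)` outside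
`δ(E_n[2]) = {(1, 1), (2n², −n), (n, −n²), (2n, n)}` ⟹
`ord_{s=1} L = 1 ∧ rank 1 ∧ Ш[2^∞] = 0 ∧ ¬ BSD(E_n, 2)`. [cite: Monsky1990MockHeegner, Remark (3) (p. 67)]
[cite: SilvermanAEC2009, Prop. X.1.4] -/
theorem rankOne_sha_not_bsdp_two_of_coordinates_not_isSquare_of_pow_nsmul_eq_congruentNumberCurve_two_mul_prod
    (hGZK : rank_eq_analyticRank_of_analyticRank_le_one) (hMe : monsky_card_selmerGroup_two_even)
    (hk : 2 ≤ k) (hp : ∀ i, (p i).Prime) (hinj : Function.Injective p) {n : ℕ}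
    (hn : 2 * ∏ i, p i = n) (h8 : n % 8 = 6) (hs : monskySelmerRankEven p = 1) (hn0 : n ≠ 0)
    {xs ys : ℚ} (hs_on : (congruentNumberCurve n).toAffine.Nonsingular xs ys) (hys : ys ≠ 0)
    (hT : deriv (congruentNumberCurve n).entireLFunction 1 =
      (4 : ℂ) * ((congruentNumberCurve n).realPeriodRat : ℂ) *
        ((Point.some xs ys hs_on : (congruentNumberCurve n).toAffine.Point).canonicalHeight : ℂ))
    {xR yR : ℚ} (hR_on : (congruentNumberCurve n).toAffine.Nonsingular xR yR) (hyR : yR ≠ 0)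
    (T₀ : (congruentNumberCurve n).toAffine.Point) (j : ℕ) (hj : j + 1 ≤ k - 2)
    (hT₀ : (2 : ℕ) • T₀ = 0)
    (hR : (2 ^ j : ℕ) • (Point.some xR yR hR_on : (congruentNumberCurve n).toAffine.Point) =
      Point.some xs ys hs_on + T₀)
    (h1 : ¬ IsSquare (xR + n) ∨ ¬ IsSquare xR)
    (h2 : ¬ IsSquare ((xR + n) * (2 * (n : ℚ) ^ 2)) ∨ ¬ IsSquare (xR * -(n : ℚ)))
    (h3 : ¬ IsSquare ((xR + n) * (n : ℚ)) ∨ ¬ IsSquare (xR * -(n : ℚ) ^ 2))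
    (h4 : ¬ IsSquare ((xR + n) * (2 * (n : ℚ))) ∨ ¬ IsSquare (xR * (n : ℚ))) :
    (congruentNumberCurve n).analyticRank = 1 ∧ (congruentNumberCurve n).mordellWeilRank = 1 ∧
      AddCommGroup.primaryComponent (congruentNumberCurve n).sha 2 = ⊥ ∧
      ¬ BSDp (congruentNumberCurve n) 2 :=
  rankOne_sha_not_bsdp_two_of_twoDescentMap_ne_of_pow_nsmul_eq_congruentNumberCurve_two_mul_prod p hGZK
    hMe hk hp hinj hn h8 hs hn0 (Point.some xs ys hs_on)
    (two_nsmul_some_ne_zero_congruentNumberCurve hn0 hs_on hys) hT (Point.some xR yR hR_on) T₀ j hj hT₀ hR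
    (forall_two_torsion_twoDescentMap_ne_of_not_isSquare hn0 hR_on hyR h1 h2 h3 h4)

end Coordinates

end Summit.BirchSwinnertonDyer.Rank1Residual.P2

end
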